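import Summits.HodgeConjecture.HodgeConjecture.Theorems.F0P3SpectralPacketAnchorsPointwise   -- ★ (N) FILE 3i′: `GlobalPacket.exists_anchor_evpAtψ_of_unitarizable` (+ ★ 3i, ★ `isUnitarizable_comap`, ★ (UN) `F0P3LocalConstituentsUnitary`, ★ FILE 2∕2b∕3a)
import Summits.HodgeConjecture.HodgeConjecture.Theorems.F0P3SpectralPacketHomogeneous        -- ★ (N) FILE 3w: `XiPacketsSignedHom`, `piXiHm` (the letter՚s (PK-SHAPE-G) witness `Π(ξ)`)
import Summits.HodgeConjecture.HodgeConjecture.Theorems.F0P3SpectralPacketRigidityReduction  -- ★ (LH7) `GlobalPacket.eq_of_loc_eq` (extensionality of `GlobalPacket`) — APPEND 1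
import HarnessLib

/-!
# UNITARIZABILITY BY OCCURRENCE — the in-house COFINITE half of the kit law (KU-G) of `TupleKitLaws`, kit-generic

Cell `hodgecm-mathlib`, F0∕P3c line LH7 (closer stub `stub_PKtuple : PKtupleLetter`, `Cruxes/H413/Lines/F0_U3LettersRung1.lean` ED. 38 «PK-ε», row #181),
crux H413 = `stmt-HodgeConjecture-24833`; organ payer LH7-p04 (g0), DEFAULT organ (u) (no deal by name at the time of writing; LH7 bus 2026-09-02).
`--supports stmt-HodgeConjecture-24833 --as helper`; closes no stub; proves no printed statement.

THE MATHEMATICS.  Row (KU-G) of the (N) tuple՚s kit laws (`TupleKitLaws`, T-A `Cruxes/H413/Lines/F0_U3LettersRung1TupleLetters.lean` :299–:300) reads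
«for every DISCRETE `G`-packet `Q` and every finite place `v` at which `Q_v` contains an unramified representation, the unramified member `π_v⁰ = sph Q_v`
is unitarizable» [Rogawski1990 §13.3 p. 199 ¶2, p. 203 ¶2; §12.2 pp. 172–174; Prop. 13.1.3 (d) p. 199], and its docstring records the honest split
«in-house only cofinitely, by occurrence — the residue is print (R8-3)».  This file IS that cofinite half, for an ARBITRARY kit family `𝔩` and with NO
hypothesis beyond discreteness:
* a family of local classes `π = (π_v)_v` that OCCURS in the discrete spectrum (★ `OccursInDiscreteSpectrum` ∕ CM currency ★ `cmOccursInDiscreteSpectrum`: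
  some discrete automorphic `P` has an irreducible admissible finite component `σ` whose constituent class at every `v` is `π_v`) is unitarizable AT EVERY
  PLACE — the `L²` inner product of `P` restricts to `σ` [BorelJacquet1979 §4.6] and `σ|_{G_v}` is `π_v`-isotypic [FlathCorvallis1979 Thm. 3]
  (★ (UN) `F0P3LocalConstituentsUnitary.exists_unitarizable_rep_of_isConstituentOf_comp_inclPlace`, ★ `isUnitarizable_of_hasFinComponent`);
* a DISCRETE global packet `Π` («some member occurs in `L²_d`», p. 199 ¶2) therefore has a member family unitarizable everywhere, and since a member IS the
  unramified representative `π_v⁰` at almost every place (★ `GlobalPacket.Mem.eventually_eq_sph`), `sph Π_v` is unitarizable for all `v` off a finite set;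
* consequently the (P4)-G anchor clause of the junction (T-B `k9stfS_of_tuple` :253, ★ 3i′ `anchorsG_of_unitarizable`) holds off a finite set WITHOUT (KU-G).
What is NOT here (print): unitarizability of `π_v⁰` at the finitely many unramified places where the occurring member is not `π_v⁰` [§12.2; Prop. 13.1.3 (d)]
— for `Π(ξ)` on the quasi-split group these are at most the `πˢ`-swap places of the multiplicity formula [Rogawski1992 Thm. 1.1].

CONTENTS (0 definitions; no instance, no notation, no named fact, no `sorry`):
* §1 (namespace ★ `…F0P3GlobalPacketDiscrete`) `OccursInDiscreteSpectrum.isUnitarizable` (generic frame `F E c N J`) and the CM currency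
  `isUnitarizable_of_cmOccursInDiscreteSpectrum` (any `N`, any Hermitian `H`).
* §2 (namespace ★ `…F0P3GlobalPacket.GlobalPacket`) `IsDiscrete.exists_mem_forall_isUnitarizable`, `IsDiscrete.eventually_isUnitarizable_sph`,
  `IsDiscrete.exists_finset_forall_isUnitarizable_sph`, `IsDiscrete.forall_isUnitarizable_sph_of_residue` (the law at `Π` from its finite residue).
* §3 (namespace ★ `…F0P3SpectralPacket.SpectralPacketG`) the same keyed on a spectral packet `Q` (`Q.isDiscrete`), and `exists_finset_anchorsG` — the (P4)-G
  anchor at every `v ∉ S₀ ∪ S₁(Q) ∪ ramG Q`, no unitarizability hypothesis.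
* §4 at the letter՚s ξ-packets: `eventually_isUnitarizable_sph_piXiHm` for the (PK-SHAPE-G) witness ★ `piXiHm hXiS ξ`.
HONEST LABEL: HC_CM is proved only modulo the 7 printed citations (2 remaining: hLiu418 = stmt-HodgeConjecture-24832, h413 = stmt-HodgeConjecture-24833) until rung 0
closes; this file discharges the cofinite part of ONE kit-law row at discrete packets and nothing else.

References: [Rogawski1990] §13.3 p. 199 ¶2, p. 203 ¶2, §12.2 pp. 172–174, §13.1 Prop. 13.1.3 (d) p. 199, §13.7 p. 206; [BorelJacquet1979] §4.6;
[FlathCorvallis1979] Thm. 3; [Rogawski1992] Thm. 1.1 p. 396; [CartierCorvallis1979] §IV.1 Cor. 4.1.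
-/

set_option autoImplicit false
-- the mandated namespace repeats `HodgeConjecture.HodgeConjecture`, as in every `Theorems/*.lean` of this sub-problem
set_option linter.dupNamespace false

noncomputable section

open NumberField IsDedekindDomain MeasureTheory Filter
open scoped Matrix MatrixGroups

open Literature.NumberTheory Literature.NumberTheory.Automorphic Literature.NumberTheory.Automorphic.UnitaryGroup
open Literature.NumberTheory.Rogawski1990 Literature.NumberTheory.GaloisRepresentations
open Literature.RepresentationTheory.BorelWallach2000 Literature.RepresentationTheory.KonnoKonno2007
open Summit.HodgeConjecture.HodgeConjecture.Cruxes.H413.F0P3InnerFormClassificationV6 (splitForm)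
open Summit.HodgeConjecture.HodgeConjecture.Cruxes.H413.F0P3LocalPacketKit
open Summit.HodgeConjecture.HodgeConjecture.Cruxes.H413.F0P3ArchPacketKit
open Summit.HodgeConjecture.HodgeConjecture.Cruxes.H413.F0P3ClassTokenChoice (isUnitarizable_comap)

/-! ## §1 Occurring families of local classes are unitarizable at every place [BorelJacquet1979 §4.6; Flath Thm. 3] -/

namespace Summit.HodgeConjecture.HodgeConjecture.Cruxes.H413.F0P3GlobalPacketDiscrete

section Generic

variable {F E : Type} [Field F] [NumberField F] [Field E] [NumberField E] [Algebra F E] {c : E ≃ₐ[F] E} {N : ℕ}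
  {J : Matrix (Fin N) (Fin N) E}
  {μ : Measure (adelicGroupData F E c N J).automorphicQuotient}
  [SMulInvariantMeasure (adelicGroupData F E c N J).Adelic (adelicGroupData F E c N J).automorphicQuotient μ]

/-- **A family of local classes that OCCURS IN THE DISCRETE SPECTRUM is unitarizable at every finite place.**  If `π = (π_v)_v` occurs (some discrete automorphic
`P` of `U(J)` has an irreducible admissible finite component `σ` whose constituent class at each `v` is `π_v`), then every `π_v` is a unitarizable class: the `L²`
inner product of `P` restricts to `σ` (★ `isUnitarizable_of_hasFinComponent`) and a constituent of the `π_v`-isotypic `σ|_{U(J)(F_v)}` carries the restricted form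
(★ `exists_unitarizable_rep_of_isConstituentOf_comp_inclPlace`).  Print: the local components of a representation occurring in `L²_d` are unitary.
[cite: BorelJacquet1979, §4.6] [cite: FlathCorvallis1979, Thm. 3] [cite: Rogawski1990, §13.3 p. 199 ¶2] -/
theorem OccursInDiscreteSpectrum.isUnitarizable {π : ∀ v : HeightOneSpectrum (𝓞 F), IrrClass (localPi E c N J v)}
    (h : OccursInDiscreteSpectrum μ π) (v : HeightOneSpectrum (𝓞 F)) : (π v).IsUnitarizable := by
  obtain ⟨P, W, _, _, σ, hirr, hadm, hP, hc⟩ := h.exists_witness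
  obtain ⟨r, hr, hru⟩ := F0P3LocalConstituentsUnitary.exists_unitarizable_rep_of_isConstituentOf_comp_inclPlace σ hirr hadm
    (F0P3LocalConstituentsUnitary.isUnitarizable_of_hasFinComponent P σ hirr hP) v (π v) (hc v)
  exact IrrClass.IsUnitarizable.of_mk_eq hr hru

end Generic

section CM

variable {L : Type} [Field L] [NumberField L] [IsCMField L] {N : ℕ} {H : Matrix (Fin N) (Fin N) L}
  {μ : Measure (adelicGroupData (↥(maximalRealSubfield L)) L (IsCMField.complexConj L) N H).automorphicQuotient}
  [SMulInvariantMeasure (adelicGroupData (↥(maximalRealSubfield L)) L (IsCMField.complexConj L) N H).Adelic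
    (adelicGroupData (↥(maximalRealSubfield L)) L (IsCMField.complexConj L) N H).automorphicQuotient μ]

/-- **CM currency: a family of classes of `U(H)(L⁺_v) = (cmDatum L N H).Local v` that occurs in the discrete spectrum is unitarizable at every place** — §1 moved back
along ★ `localPiEquiv` (★ `IrrClass.comap_symm_comap`, ★ `isUnitarizable_comap`). [cite: BorelJacquet1979, §4.6] [cite: FlathCorvallis1979, Thm. 3] [cite: Rogawski1990, §13.3 p. 199 ¶2] -/
theorem isUnitarizable_of_cmOccursInDiscreteSpectrum
    {π : ∀ v : HeightOneSpectrum (𝓞 ↥(maximalRealSubfield L)), IrrClass ((cmDatum L N H).Local v)}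
    (h : cmOccursInDiscreteSpectrum L N H μ π) (v : HeightOneSpectrum (𝓞 ↥(maximalRealSubfield L))) : (π v).IsUnitarizable := by
  have h₁ : (IrrClass.comap (localPiEquiv L (IsCMField.complexConj L) N H v) (π v)).IsUnitarizable :=
    OccursInDiscreteSpectrum.isUnitarizable (π := fun w => IrrClass.comap (localPiEquiv L (IsCMField.complexConj L) N H w) (π w)) h v
  rw [← IrrClass.comap_symm_comap (localPiEquiv L (IsCMField.complexConj L) N H v) (π v)]
  exact isUnitarizable_comap _ h₁

end CM

end Summit.HodgeConjecture.HodgeConjecture.Cruxes.H413.F0P3GlobalPacketDiscrete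

/-! ## §2 Discrete global packets over a kit family: the unramified member is unitarizable off a finite set [p. 199 ¶2; §12.2] -/

namespace Summit.HodgeConjecture.HodgeConjecture.Cruxes.H413.F0P3GlobalPacket.GlobalPacket

open Summit.HodgeConjecture.HodgeConjecture.Cruxes.H413.F0P3GlobalPacketDiscrete

variable {L : Type} [Field L] [NumberField L] [IsCMField L] {H' : Matrix (Fin 3) (Fin 3) L}
  {𝔩 : ∀ v : HeightOneSpectrum (𝓞 ↥(maximalRealSubfield L)), LocalPacketKit L H' v}
  {μ : Measure (adelicGroupData (↥(maximalRealSubfield L)) L (IsCMField.complexConj L) 3 H').automorphicQuotient}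
  [SMulInvariantMeasure (adelicGroupData (↥(maximalRealSubfield L)) L (IsCMField.complexConj L) 3 H').Adelic
    (adelicGroupData (↥(maximalRealSubfield L)) L (IsCMField.complexConj L) 3 H').automorphicQuotient μ]

/-- **A DISCRETE global packet has a member family that is unitarizable at every finite place** — the occurring member of the definition «`Π` is discrete if some
member occurs in `L²_d`» (p. 199 ¶2), unitarizable by §1. [cite: Rogawski1990, §13.3 p. 199 ¶2] [cite: BorelJacquet1979, §4.6] [cite: FlathCorvallis1979, Thm. 3] -/
theorem IsDiscrete.exists_mem_forall_isUnitarizable {Pg : GlobalPacket 𝔩} (h : Pg.IsDiscrete μ) :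
    ∃ π : ∀ v : HeightOneSpectrum (𝓞 ↥(maximalRealSubfield L)), IrrClass ((cmDatum L 3 H').Local v),
      Pg.Mem π ∧ ∀ v : HeightOneSpectrum (𝓞 ↥(maximalRealSubfield L)), (π v).IsUnitarizable := by
  obtain ⟨π, hπ, hocc⟩ := h.exists_mem
  exact ⟨π, hπ, fun v => isUnitarizable_of_cmOccursInDiscreteSpectrum hocc v⟩

/-- **THE COFINITE HALF OF (KU-G) AT A DISCRETE PACKET, NO HYPOTHESIS**: for a discrete global packet `Π` over ANY kit family, the unramified member `π_v⁰ = sph Π_v` is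
unitarizable at all but finitely many places — namely wherever the occurring member IS `π_v⁰` (★ `Mem.eventually_eq_sph`).  The residue (the finitely many unramified places
where the occurring member is another member of `Π_v`) is print [§12.2 pp. 172–174; Prop. 13.1.3 (d)].
[cite: Rogawski1990, §13.3 p. 199 ¶2, p. 203 ¶2; §12.2 pp. 172–174] [cite: BorelJacquet1979, §4.6] -/
theorem IsDiscrete.eventually_isUnitarizable_sph {Pg : GlobalPacket 𝔩} (h : Pg.IsDiscrete μ) :
    ∀ᶠ v : HeightOneSpectrum (𝓞 ↥(maximalRealSubfield L)) in cofinite,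
      ∀ hu : (𝔩 v).unr (Pg.loc v), ((𝔩 v).sph (Pg.loc v) hu).IsUnitarizable := by
  obtain ⟨π, hπ, hunit⟩ := h.exists_mem_forall_isUnitarizable
  filter_upwards [hπ.eventually_eq_sph] with v hv hu
  obtain ⟨hu', heq⟩ := hv
  have hs : (𝔩 v).sph (Pg.loc v) hu = π v := heq.symm
  rw [hs]
  exact hunit v

/-- Finset form of `eventually_isUnitarizable_sph`: an exceptional finite set `S₁` off which `sph Π_v` is unitarizable.
[cite: Rogawski1990, §13.3 p. 199 ¶2; §12.2 pp. 172–174] [cite: BorelJacquet1979, §4.6] -/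
theorem IsDiscrete.exists_finset_forall_isUnitarizable_sph {Pg : GlobalPacket 𝔩} (h : Pg.IsDiscrete μ) :
    ∃ S₁ : Finset (HeightOneSpectrum (𝓞 ↥(maximalRealSubfield L))),
      ∀ v ∉ S₁, ∀ hu : (𝔩 v).unr (Pg.loc v), ((𝔩 v).sph (Pg.loc v) hu).IsUnitarizable := by
  have hf := Filter.eventually_cofinite.1 h.eventually_isUnitarizable_sph
  refine ⟨hf.toFinset, fun v hv => ?_⟩
  by_contra hcon
  exact hv (hf.mem_toFinset.2 hcon)

/-- **The law at `Π` from its finite residue**: (KU-G) at the discrete packet `Π` — «`sph Π_v` unitarizable at EVERY unramified place» — follows from its truth on the finite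
exceptional set of `exists_finset_forall_isUnitarizable_sph` alone (the print residue, R8-3). [cite: Rogawski1990, §13.3 p. 199 ¶2; §12.2 pp. 172–174; §13.1 Prop. 13.1.3 (d) p. 199] -/
theorem IsDiscrete.forall_isUnitarizable_sph_of_residue {Pg : GlobalPacket 𝔩} (h : Pg.IsDiscrete μ) :
    ∃ S₁ : Finset (HeightOneSpectrum (𝓞 ↥(maximalRealSubfield L))),
      (∀ v ∈ S₁, ∀ hu : (𝔩 v).unr (Pg.loc v), ((𝔩 v).sph (Pg.loc v) hu).IsUnitarizable) →
        ∀ (v : HeightOneSpectrum (𝓞 ↥(maximalRealSubfield L))) (hu : (𝔩 v).unr (Pg.loc v)), ((𝔩 v).sph (Pg.loc v) hu).IsUnitarizable := by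
  obtain ⟨S₁, hS₁⟩ := h.exists_finset_forall_isUnitarizable_sph
  refine ⟨S₁, fun hres v hu => ?_⟩
  by_cases hv : v ∈ S₁
  · exact hres v hv hu
  · exact hS₁ v hv hu

end Summit.HodgeConjecture.HodgeConjecture.Cruxes.H413.F0P3GlobalPacket.GlobalPacket

/-! ## §3 At a spectral packet `Q : SpectralPacketG 𝔩 𝔞 μ` (discrete by `Q.isDiscrete`), and the (P4)-G anchor clause off a finite set without (KU-G) [§13.7 p. 206] -/

namespace Summit.HodgeConjecture.HodgeConjecture.Cruxes.H413.F0P3SpectralPacket.SpectralPacketG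

open Summit.HodgeConjecture.HodgeConjecture.Cruxes.H413.F0P3GlobalPacket
open Summit.HodgeConjecture.HodgeConjecture.Cruxes.H413.F0P3GlobalPacketDiscrete

section AnyForm

variable {L : Type} [Field L] [NumberField L] [IsCMField L] {H' : Matrix (Fin 3) (Fin 3) L}
  {𝔩 : ∀ v : HeightOneSpectrum (𝓞 ↥(maximalRealSubfield L)), LocalPacketKit L H' v} {𝔞 : ArchPacketKit}
  {μ : Measure (adelicGroupData (↥(maximalRealSubfield L)) L (IsCMField.complexConj L) 3 H').automorphicQuotient}
  [SMulInvariantMeasure (adelicGroupData (↥(maximalRealSubfield L)) L (IsCMField.complexConj L) 3 H').Adelic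
    (adelicGroupData (↥(maximalRealSubfield L)) L (IsCMField.complexConj L) 3 H').automorphicQuotient μ]

/-- A spectral `G`-packet has a member family unitarizable at every finite place (its discrete witness). [cite: Rogawski1990, §13.3 p. 199 ¶2, p. 203 ¶2] [cite: BorelJacquet1979, §4.6] -/
theorem exists_mem_forall_isUnitarizable (Q : SpectralPacketG 𝔩 𝔞 μ) :
    ∃ π : ∀ v : HeightOneSpectrum (𝓞 ↥(maximalRealSubfield L)), IrrClass ((cmDatum L 3 H').Local v),
      Q.fin.Mem π ∧ ∀ v : HeightOneSpectrum (𝓞 ↥(maximalRealSubfield L)), (π v).IsUnitarizable :=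
  GlobalPacket.IsDiscrete.exists_mem_forall_isUnitarizable Q.isDiscrete

/-- **(KU-G) AT `Q`, COFINITELY, NO HYPOTHESIS**: `sph Q_v` is unitarizable at all but finitely many places. [cite: Rogawski1990, §13.3 p. 199 ¶2, p. 203 ¶2; §12.2 pp. 172–174] [cite: BorelJacquet1979, §4.6] -/
theorem eventually_isUnitarizable_sph (Q : SpectralPacketG 𝔩 𝔞 μ) :
    ∀ᶠ v : HeightOneSpectrum (𝓞 ↥(maximalRealSubfield L)) in cofinite,
      ∀ hu : (𝔩 v).unr (Q.fin.loc v), ((𝔩 v).sph (Q.fin.loc v) hu).IsUnitarizable :=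
  GlobalPacket.IsDiscrete.eventually_isUnitarizable_sph Q.isDiscrete

/-- Finset form: an exceptional finite set `S₁(Q)` off which `sph Q_v` is unitarizable. [cite: Rogawski1990, §13.3 p. 199 ¶2; §12.2 pp. 172–174] [cite: BorelJacquet1979, §4.6] -/
theorem exists_finset_forall_isUnitarizable_sph (Q : SpectralPacketG 𝔩 𝔞 μ) :
    ∃ S₁ : Finset (HeightOneSpectrum (𝓞 ↥(maximalRealSubfield L))),
      ∀ v ∉ S₁, ∀ hu : (𝔩 v).unr (Q.fin.loc v), ((𝔩 v).sph (Q.fin.loc v) hu).IsUnitarizable :=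
  GlobalPacket.IsDiscrete.exists_finset_forall_isUnitarizable_sph Q.isDiscrete

/-- **(KU-G) at `Q` from its finite residue** (the print part, R8-3, isolated as the only remaining input). [cite: Rogawski1990, §13.3 p. 199 ¶2; §12.2 pp. 172–174; §13.1 Prop. 13.1.3 (d) p. 199] -/
theorem forall_isUnitarizable_sph_of_residue (Q : SpectralPacketG 𝔩 𝔞 μ) :
    ∃ S₁ : Finset (HeightOneSpectrum (𝓞 ↥(maximalRealSubfield L))),
      (∀ v ∈ S₁, ∀ hu : (𝔩 v).unr (Q.fin.loc v), ((𝔩 v).sph (Q.fin.loc v) hu).IsUnitarizable) →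
        ∀ (v : HeightOneSpectrum (𝓞 ↥(maximalRealSubfield L))) (hu : (𝔩 v).unr (Q.fin.loc v)), ((𝔩 v).sph (Q.fin.loc v) hu).IsUnitarizable :=
  GlobalPacket.IsDiscrete.forall_isUnitarizable_sph_of_residue Q.isDiscrete

end AnyForm

section SplitForm

variable {L : Type} [Field L] [NumberField L] [IsCMField L] {H : Matrix (Fin 3) (Fin 3) L}
  {𝔩 : ∀ v : HeightOneSpectrum (𝓞 ↥(maximalRealSubfield L)), LocalPacketKit L (splitForm L 3) v} {𝔞 : ArchPacketKit}
  {μ : Measure (adelicGroupData (↥(maximalRealSubfield L)) L (IsCMField.complexConj L) 3 (splitForm L 3)).automorphicQuotient}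
  [SMulInvariantMeasure (adelicGroupData (↥(maximalRealSubfield L)) L (IsCMField.complexConj L) 3 (splitForm L 3)).Adelic
    (adelicGroupData (↥(maximalRealSubfield L)) L (IsCMField.complexConj L) 3 (splitForm L 3)).automorphicQuotient μ]
  [∀ v : HeightOneSpectrum (𝓞 ↥(maximalRealSubfield L)), MeasurableSpace ((cmDatum L 3 (splitForm L 3)).Local v)]
  [∀ v : HeightOneSpectrum (𝓞 ↥(maximalRealSubfield L)), BorelSpace ((cmDatum L 3 (splitForm L 3)).Local v)]
  [∀ v : HeightOneSpectrum (𝓞 ↥(maximalRealSubfield L)), MeasurableSpace ((cmDatum L 3 H).Local v)]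
  [∀ v : HeightOneSpectrum (𝓞 ↥(maximalRealSubfield L)), BorelSpace ((cmDatum L 3 H).Local v)]
  {νG' : ∀ v : HeightOneSpectrum (𝓞 ↥(maximalRealSubfield L)), Measure ((cmDatum L 3 H).Local v)}
  [∀ v, (νG' v).IsMulLeftInvariant] [∀ v, IsFiniteMeasureOnCompacts (νG' v)]

/-- **THE (P4)-G ANCHOR CLAUSE OFF A FINITE SET, WITHOUT (KU-G)**: for a discrete packet `Q` on the quasi-split group there is a finite `S₁ = S₁(Q)` such that at every
`v ∉ S₀`, `v ∉ S₁`, `v ∉ ramG Q` (with `ψ_v(K′_v) = K_v`, `ν′_v(K′_v) ≠ 0`, (ℓ4) `UnramLaw` and «`sph` admissible» as in ★ 3i′) there is an admissible unitarizable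
`K′_v`-spherical class of `G′_v` WITH e.v.p. `evpG Q v` — ★ 3i′ `exists_anchor_evpAtψ_of_unitarizable` fed by `exists_finset_forall_isUnitarizable_sph`.
[cite: Rogawski1990, §13.7 p. 206; §4.5 p. 45; §13.3 p. 199 ¶2; §12.2 pp. 172–174] [cite: CartierCorvallis1979, §IV.1 Cor. 4.1] [cite: BorelJacquet1979, §4.6] -/
theorem exists_finset_anchorsG (Q : SpectralPacketG 𝔩 𝔞 μ)
    (ψ : ∀ v : HeightOneSpectrum (𝓞 ↥(maximalRealSubfield L)), (cmDatum L 3 H).Local v ≃ₜ* (cmDatum L 3 (splitForm L 3)).Local v)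
    (h4 : ∀ v : HeightOneSpectrum (𝓞 ↥(maximalRealSubfield L)), (𝔩 v).UnramLaw)
    (hadm : ∀ (v : HeightOneSpectrum (𝓞 ↥(maximalRealSubfield L))) (P : (𝔩 v).Pkt) (h : (𝔩 v).unr P), ((𝔩 v).sph P h).IsAdmissible)
    (S₀ : Finset (HeightOneSpectrum (𝓞 ↥(maximalRealSubfield L))))
    (hψK : ∀ v ∉ S₀, (cmLocalIntegralLevel L 3 H v).map (ψ v : (cmDatum L 3 H).Local v →* (cmDatum L 3 (splitForm L 3)).Local v) =
      cmLocalIntegralLevel L 3 (splitForm L 3) v)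
    (hμK : ∀ v : HeightOneSpectrum (𝓞 ↥(maximalRealSubfield L)), (νG' v).real (cmLocalIntegralLevel L 3 H v : Set ((cmDatum L 3 H).Local v)) ≠ 0) :
    ∃ S₁ : Finset (HeightOneSpectrum (𝓞 ↥(maximalRealSubfield L))),
      ∀ v : HeightOneSpectrum (𝓞 ↥(maximalRealSubfield L)), v ∉ S₀ → v ∉ S₁ → v ∉ Q.fin.ramFinset →
        ∃ π : IrrClass ((cmDatum L 3 H).Local v), π.IsAdmissible ∧ π.IsUnitarizable ∧
          π.IsSphericalWith (cmLocalIntegralLevel L 3 H v) (νG' v) (Q.evpGψ ψ (fun w => (νG' w).map (ψ w)) v) := by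
  obtain ⟨S₁, hS₁⟩ := Q.exists_finset_forall_isUnitarizable_sph
  exact ⟨S₁, fun v hv hv₁ hram => Q.fin.exists_anchor_evpAtψ_of_unitarizable ψ νG' h4 hadm (hS₁ v hv₁) (hψK v hv) (hμK v) hram⟩

end SplitForm

/-! ## §4 At the letter՚s ξ-packets `Π(ξ) = piXiHm hXiS ξ` ((PK-SHAPE-G) witness) [Thm. 13.3.6 (b); §12.2] -/

section XiPackets

variable {L : Type} [Field L] [NumberField L] [IsCMField L] {H' : Matrix (Fin 3) (Fin 3) L}
  {𝔩 : ∀ v : HeightOneSpectrum (𝓞 ↥(maximalRealSubfield L)), LocalPacketKit L H' v} {𝔞 : ArchPacketKit}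
  {μ : Measure (adelicGroupData (↥(maximalRealSubfield L)) L (IsCMField.complexConj L) 3 H').automorphicQuotient}
  [SMulInvariantMeasure (adelicGroupData (↥(maximalRealSubfield L)) L (IsCMField.complexConj L) 3 H').Adelic
    (adelicGroupData (↥(maximalRealSubfield L)) L (IsCMField.complexConj L) 3 H').automorphicQuotient μ]
  {infOf : GlobalPacket 𝔩 → 𝔞.PktInf} {aTok : ∀ v : HeightOneSpectrum (𝓞 ↥(maximalRealSubfield L)), Set (𝔩 v).Pkt}
  {PkX : OneDimAutRepH L → ∀ v : HeightOneSpectrum (𝓞 ↥(maximalRealSubfield L)), CMLocalAPacket L H' v}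
  {PkInfX : OneDimAutRepH L → LocalAPacket (GKIrrClass (uFormGroup (Fin 2) (Fin 1)))} {κX : OneDimAutRepH L → ℤ}

/-- **(KU-G) AT THE ξ-PACKET `Π(ξ)`, COFINITELY**: for the (PK-SHAPE-G) witness ★ `piXiHm hXiS ξ` (discrete, Thm. 13.3.6 (b)), the unramified member of `Π(ξ)_v` is unitarizable
at all but finitely many places, with no further input. [cite: Rogawski1990, §13.3 Thm. 13.3.6 (b) p. 202, p. 199 ¶2; §12.2 pp. 172–174] [cite: BorelJacquet1979, §4.6] -/
theorem eventually_isUnitarizable_sph_piXiHm (hXiS : XiPacketsSignedHom 𝔩 𝔞 μ infOf aTok PkX PkInfX κX) (ξ : OneDimAutRepH L) :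
    ∀ᶠ v : HeightOneSpectrum (𝓞 ↥(maximalRealSubfield L)) in cofinite,
      ∀ hu : (𝔩 v).unr ((piXiHm hXiS ξ).1.fin.loc v), ((𝔩 v).sph ((piXiHm hXiS ξ).1.fin.loc v) hu).IsUnitarizable :=
  (piXiHm hXiS ξ).1.eventually_isUnitarizable_sph

/-- Finset form at `Π(ξ)`. [cite: Rogawski1990, §13.3 Thm. 13.3.6 (b) p. 202; §12.2 pp. 172–174] [cite: BorelJacquet1979, §4.6] -/
theorem exists_finset_forall_isUnitarizable_sph_piXiHm (hXiS : XiPacketsSignedHom 𝔩 𝔞 μ infOf aTok PkX PkInfX κX) (ξ : OneDimAutRepH L) :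
    ∃ S₁ : Finset (HeightOneSpectrum (𝓞 ↥(maximalRealSubfield L))),
      ∀ v ∉ S₁, ∀ hu : (𝔩 v).unr ((piXiHm hXiS ξ).1.fin.loc v), ((𝔩 v).sph ((piXiHm hXiS ξ).1.fin.loc v) hu).IsUnitarizable :=
  (piXiHm hXiS ξ).1.exists_finset_forall_isUnitarizable_sph

end XiPackets

end Summit.HodgeConjecture.HodgeConjecture.Cruxes.H413.F0P3SpectralPacket.SpectralPacketG

/-! ## §5 (APPEND 1) The (KU-H) twin at an `H`-packet `ρ` whose image `Π(ρ) = ξ_H(ρ)` is a discrete `G`-packet [Thm. 13.3.4 p. 202; p. 199 ¶2; §12.2]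

Row (KU-H) of `TupleKitLaws` (T-A :305–:306) asks, for every spectral `H`-packet `ρ`, that the unramified member of `ξ_H(ρ_v) = (ρ.imageG).loc v` be unitarizable.  The kit types no
automorphic content on the `H`-side (`SpectralPacketH.isDiscrete` is the parameter predicate `DiscH`), so occurrence is available only through the IMAGE: whenever `ρ.imageG` is a
discrete `G`-packet — in the letter, for `ρ = ρ(ξ) = rhoXiS hXiHS ξ` as soon as the kit identifies `ξ_H(ρ(ξ)_v)` with the token `Π(ξ)_v = (piXiHm hXiS ξ).1.fin.loc v`
(`(piXiHm hXiS ξ).1.fin.IsImageOf (rhoXiS hXiHS ξ).fin`, the same hypothesis `himg` as ★ `F0P3GlobalPacketNValues`) — §2 applies verbatim and (KU-H) at `ρ` is print only on a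
finite residue. -/

namespace Summit.HodgeConjecture.HodgeConjecture.Cruxes.H413.F0P3GlobalPacket.GlobalPacket

variable {L : Type} [Field L] [NumberField L] [IsCMField L] {H' : Matrix (Fin 3) (Fin 3) L}
  {𝔩 : ∀ v : HeightOneSpectrum (𝓞 ↥(maximalRealSubfield L)), LocalPacketKit L H' v}

/-- `Π.IsImageOf ρ` says `ξ_H(ρ_v) = Π_v` at every `v` (read-back of ★ FILE 2 `IsImageOf`, oriented for rewriting). [cite: Rogawski1990, §13.1 p. 199; §13.3 Thm. 13.3.4 p. 202] -/
theorem IsImageOf.xiH_loc_eq {Pg : GlobalPacket 𝔩} {ρ : GlobalPacketH 𝔩} (h : Pg.IsImageOf ρ) (v : HeightOneSpectrum (𝓞 ↥(maximalRealSubfield L))) :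
    (𝔩 v).xiH (ρ.loc v) = Pg.loc v :=
  h v

end Summit.HodgeConjecture.HodgeConjecture.Cruxes.H413.F0P3GlobalPacket.GlobalPacket

namespace Summit.HodgeConjecture.HodgeConjecture.Cruxes.H413.F0P3SpectralPacket.SpectralPacketH

open Summit.HodgeConjecture.HodgeConjecture.Cruxes.H413.F0P3GlobalPacket
open Summit.HodgeConjecture.HodgeConjecture.Cruxes.H413.F0P3ArchPacketKit.ArchPacketKitH

variable {L : Type} [Field L] [NumberField L] [IsCMField L] {H' : Matrix (Fin 3) (Fin 3) L}
  {𝔩 : ∀ v : HeightOneSpectrum (𝓞 ↥(maximalRealSubfield L)), LocalPacketKit L H' v} {𝔞 : ArchPacketKit} {𝔞H : ArchPacketKitH 𝔞}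
  {DiscH : GlobalPacketH 𝔩 → 𝔞H.PktInfH → Prop}
  {μ : Measure (adelicGroupData (↥(maximalRealSubfield L)) L (IsCMField.complexConj L) 3 H').automorphicQuotient}
  [SMulInvariantMeasure (adelicGroupData (↥(maximalRealSubfield L)) L (IsCMField.complexConj L) 3 H').Adelic
    (adelicGroupData (↥(maximalRealSubfield L)) L (IsCMField.complexConj L) 3 H').automorphicQuotient μ]

/-- `Π(ρ) = ρ.imageG` IS any global packet of which `ρ` is a preimage (token identity placewise). [cite: Rogawski1990, §13.1 p. 199; §13.3 Thm. 13.3.4 p. 202] -/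
theorem imageG_eq_of_isImageOf (ρ : SpectralPacketH 𝔩 𝔞 𝔞H DiscH) {Pg : GlobalPacket 𝔩} (himg : Pg.IsImageOf ρ.fin) : ρ.imageG = Pg :=
  GlobalPacket.eq_of_loc_eq fun v => himg v

/-- If `Π(ρ) = Q_f` for a spectral (discrete) `G`-packet `Q`, then `ρ.imageG` is discrete. [cite: Rogawski1990, §13.3 Thm. 13.3.4 p. 202, p. 199 ¶2] -/
theorem isDiscrete_imageG_of_isImageOf (ρ : SpectralPacketH 𝔩 𝔞 𝔞H DiscH) (Q : SpectralPacketG 𝔩 𝔞 μ) (himg : Q.fin.IsImageOf ρ.fin) :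
    ρ.imageG.IsDiscrete μ := by
  rw [ρ.imageG_eq_of_isImageOf himg]
  exact Q.isDiscrete

/-- **(KU-H) AT `ρ`, COFINITELY, when `Π(ρ)` is discrete**: the unramified member of `ξ_H(ρ_v)` is unitarizable at all but finitely many places (§2 at `ρ.imageG`).
[cite: Rogawski1990, §13.3 Thm. 13.3.4 p. 202, p. 199 ¶2; §12.2 pp. 172–174] [cite: BorelJacquet1979, §4.6] -/
theorem eventually_isUnitarizable_sph_imageG (ρ : SpectralPacketH 𝔩 𝔞 𝔞H DiscH) (hdisc : ρ.imageG.IsDiscrete μ) :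
    ∀ᶠ v : HeightOneSpectrum (𝓞 ↥(maximalRealSubfield L)) in cofinite,
      ∀ hu : (𝔩 v).unr (ρ.imageG.loc v), ((𝔩 v).sph (ρ.imageG.loc v) hu).IsUnitarizable :=
  GlobalPacket.IsDiscrete.eventually_isUnitarizable_sph hdisc

/-- Finset form of `eventually_isUnitarizable_sph_imageG`. [cite: Rogawski1990, §13.3 Thm. 13.3.4 p. 202; §12.2 pp. 172–174] [cite: BorelJacquet1979, §4.6] -/
theorem exists_finset_forall_isUnitarizable_sph_imageG (ρ : SpectralPacketH 𝔩 𝔞 𝔞H DiscH) (hdisc : ρ.imageG.IsDiscrete μ) :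
    ∃ S₁ : Finset (HeightOneSpectrum (𝓞 ↥(maximalRealSubfield L))),
      ∀ v ∉ S₁, ∀ hu : (𝔩 v).unr (ρ.imageG.loc v), ((𝔩 v).sph (ρ.imageG.loc v) hu).IsUnitarizable :=
  GlobalPacket.IsDiscrete.exists_finset_forall_isUnitarizable_sph hdisc

/-- **(KU-H) at `ρ` from its finite residue** when `Π(ρ)` is discrete (T-B reads `hKUH ρ : ∀ v h, (sph (ρ.imageG.loc v) h).IsUnitarizable`; this isolates the print part).
[cite: Rogawski1990, §13.3 Thm. 13.3.4 p. 202, Thm. 13.3.7 pp. 202–203; §12.2 pp. 172–174; §13.1 Prop. 13.1.2 p. 198] -/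
theorem forall_isUnitarizable_sph_imageG_of_residue (ρ : SpectralPacketH 𝔩 𝔞 𝔞H DiscH) (hdisc : ρ.imageG.IsDiscrete μ) :
    ∃ S₁ : Finset (HeightOneSpectrum (𝓞 ↥(maximalRealSubfield L))),
      (∀ v ∈ S₁, ∀ hu : (𝔩 v).unr (ρ.imageG.loc v), ((𝔩 v).sph (ρ.imageG.loc v) hu).IsUnitarizable) →
        ∀ (v : HeightOneSpectrum (𝓞 ↥(maximalRealSubfield L))) (hu : (𝔩 v).unr (ρ.imageG.loc v)), ((𝔩 v).sph (ρ.imageG.loc v) hu).IsUnitarizable :=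
  GlobalPacket.IsDiscrete.forall_isUnitarizable_sph_of_residue hdisc

/-- **(KU-H) AT `ρ`, COFINITELY, from `Q_f = Π(ρ)`** for a spectral `G`-packet `Q` (the letter: `Q := (piXiHm hXiS ξ).1`, `ρ := rhoXiS hXiHS ξ`, `himg` the kit՚s token identity
`ξ_H(ρ(ξ)_v) = Π(ξ)_v`). [cite: Rogawski1990, §13.3 Thm. 13.3.4 p. 202, Thm. 13.3.6 (b) p. 202; §12.2 pp. 172–174] [cite: BorelJacquet1979, §4.6] -/
theorem eventually_isUnitarizable_sph_imageG_of_isImageOf (ρ : SpectralPacketH 𝔩 𝔞 𝔞H DiscH) (Q : SpectralPacketG 𝔩 𝔞 μ) (himg : Q.fin.IsImageOf ρ.fin) :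
    ∀ᶠ v : HeightOneSpectrum (𝓞 ↥(maximalRealSubfield L)) in cofinite,
      ∀ hu : (𝔩 v).unr (ρ.imageG.loc v), ((𝔩 v).sph (ρ.imageG.loc v) hu).IsUnitarizable :=
  ρ.eventually_isUnitarizable_sph_imageG (ρ.isDiscrete_imageG_of_isImageOf Q himg)

/-- **(KU-H) at `ρ` from its finite residue, from `Q_f = Π(ρ)`.** [cite: Rogawski1990, §13.3 Thm. 13.3.4 p. 202, Thm. 13.3.7 pp. 202–203; §12.2 pp. 172–174] -/
theorem forall_isUnitarizable_sph_imageG_of_residue_of_isImageOf (ρ : SpectralPacketH 𝔩 𝔞 𝔞H DiscH) (Q : SpectralPacketG 𝔩 𝔞 μ)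
    (himg : Q.fin.IsImageOf ρ.fin) :
    ∃ S₁ : Finset (HeightOneSpectrum (𝓞 ↥(maximalRealSubfield L))),
      (∀ v ∈ S₁, ∀ hu : (𝔩 v).unr (ρ.imageG.loc v), ((𝔩 v).sph (ρ.imageG.loc v) hu).IsUnitarizable) →
        ∀ (v : HeightOneSpectrum (𝓞 ↥(maximalRealSubfield L))) (hu : (𝔩 v).unr (ρ.imageG.loc v)), ((𝔩 v).sph (ρ.imageG.loc v) hu).IsUnitarizable :=
  ρ.forall_isUnitarizable_sph_imageG_of_residue (ρ.isDiscrete_imageG_of_isImageOf Q himg)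

end Summit.HodgeConjecture.HodgeConjecture.Cruxes.H413.F0P3SpectralPacket.SpectralPacketH

end
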